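/-
Copyright: the b2b-balaban T⁴-continuum CRUX team, row NE7b OWNER lineage `t4-ne7b-p1` (gen 122). Project licence.
-/
import Summits.QuantumFields.BalabanUV.T4Continuum.Spine.NE7b.SupTorusPointwiseDecayRoad
import Summits.QuantumFields.BalabanUV.T4Continuum.Spine.NE7b.SupTorusResponseOperatorLocality

/-!
# THE POINTWISE COLUMN ON THE ROAD'S OWN CLASS `−λ ≤ V ≤ Λ` (EITHER SIGN), `d ≥ 3`, BY NAME: the propagator `H_V⁻¹𝟙_{B_{y₀}}f`, the
# response `h_{y₀} = Σ_{y′}T⁻¹(y′,y₀)ψ_{y′}` (`= Dt e_{y₀}`), the fluctuation covariance `Cf = u − Σ_{y′}(T⁻¹Q′tu)(y′)ψ_{y′}`, and the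
# road's own response OPERATOR `Dt` of (100) all satisfy `e^{δρ_s(bt x, y₀)}·|·(x)| ≤ C(·M)` at EVERY site — (154) `pointwise_decay_road`
# read on the sources `𝟙_{B_{y₀}}f`, `T⁻¹(bt ·, y₀)` ((135)∕(137)), `f − (T⁻¹Q′tu)∘bt` ((139) `coeff_le`), and (150)'s identification
# `Dt k = Σ(Mt k)ψ` — the road's-class twins of (146) `response_pointwise_decay`, (147) `propagator_pointwise_decay` ∕
# `covariance_pointwise_decay`, (150) `response_operator_pointwise`, WITHOUT the strict-convexity floor `v₀ > 0`
# (row NE7b, node U5c; (133)∕(135)∕(137)∕(139)∕(144)∕(150)∕(154) BY NAME; [folklore])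

Cell `pub-balaban`, sub-cell `t4`, spine estimate NE7b (`T4WeightBudget.RelWeightBound`; the cell's OWN estimate — NOT PRINTED in
[Bałaban 1983–89], NOT PROVED).  Crux-route work under `Spine/NE7b/` by the row OWNER (`t4-ne7b-p1` gen 122, file (155)) under FREEZE
(0)'s crux-prover clause; NOTHING of Bałaban's is named as a Lean object, valued or asserted; no `T4Continuum/Support` leaf typed; no `def`,
no notation (the action and every operator DISPLAYED exactly as in (133)–(154)); zero `sorry`.  Imports (BY NAME): the OWNER's (154)
`…SupTorusPointwiseDecayRoad` (`pointwise_decay_road`; through it (144) `blockRMS_le_of_block_source`, `blockTerm_eq`, (139) `coeff_le`,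
`covariance_local`, (137) `response_local`, (135) `nextScale_hessian_local`, (133) `action_sub`, `action_sum_smul`, (131) `exists_rate`,
(89) TDF `siteOf_chart_surjective`), (150) `…SupTorusResponseOperatorLocality` (`response_eq_superposition`).

WHY (located).  The pointwise column (146)∕(147)∕(149)∕(150) rests on the maximum principle for `L_V = (n+1)²(−Δ) + V`, hence on the
strictly convex single-site class `V ≥ v₀ > 0`; the road's class of record is `u′ ≥ −λ`, `λ < min(2,a)` (slightly NON-convex single-site
potentials stabilised by the block term).  (154) gives, on that class, `|f| ≤ M·e^{−γρ_s(bt ·, y₀)}` ⟹ `e^{δρ_s(bt x, y₀)}|H_V⁻¹f|(x) ≤ C·M`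
by interior regularity.  Each object of the column IS an `H_V⁻¹` of a source with such a profile: a block source (any `γ`); the response's
source `T⁻¹(bt ·, y₀)` ((137) `response_local`, profile `c₁e^{−δ₁ρ_s}` by (135)); the fluctuation part's source `f − c∘bt`,
`c = T⁻¹(Q′tu)` ((139) `coeff_le`, profile `(1 + c₁m_κ⁻¹e^{2dκ}K)M·e^{−δ′ρ_s}`, the displays of `u − h` by (133) `action_sub` ∕
`action_sum_smul`); and `Dt e_{y₀}` IS the response by (150) `response_eq_superposition`.

WHAT IS PROVED ([folklore]; fine torus `Site d ((n+1)s)`, coarse `Site d s`, `[NeZero s]`; the action DISPLAYED; `σ = siteOf`, `bt x =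
σ_s(blk n (wm x))`, `ρ_s` the `ℓ¹` circular distance; `T = Matrix.of (y,y″ ↦ (n+1)^{−d}Σ_z ψ_{y″}(σ(chart (wm y) z)))`; throughout `d ≥ 3`,
`a > 0`, `λ < min(2,a)`, `Λ ≥ 0`, conclusions for ALL `n, s`, ALL `−λ ≤ V ≤ Λ`, with `∃ C δ > 0` functions of `(d, a, λ, Λ)` and `C(d)` only):
* §1 **`propagator_pointwise_decay_road`**: `f` supported in the block `y₀`, `|f| ≤ M`, `Hu = f` ⟹ `e^{δρ_s(bt x, y₀)}·|u x| ≤ C·M` every `x`.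
* §2 **`response_pointwise_decay_road`**: block columns `ψ` ⟹ `e^{δρ_s(bt x, y₀)}·|Σ_{y′}T⁻¹(y′,y₀)ψ_{y′}(x)| ≤ C` every `y₀, x`.
* §3 **`covariance_pointwise_decay_road`**: block columns `ψ`, `f` supported in `y₀`, `|f| ≤ M`, `Hu = f` ⟹
  `e^{δρ_s(bt x, y₀)}·|u x − Σ_{y′}(Σ_{y″}T⁻¹(y′,y″)(n+1)^{−d}Σ_z u(σ(chart (wm y″) z)))ψ_{y′}(x)| ≤ C·M` every `x`.
* §4 **`response_operator_pointwise_road`**: for the road's operators `Dop, Aop, Ef, Rf, Rc`, `u′(φ ·) ∈ [−λ, Λ]`, `Dt` with `Q′t(Dt k) = k`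
  and the fibre-killing display, `Mt` with (102)'s display ((150)'s quantifier prefix verbatim): `e^{δρ_s(bt x, y₀)}·|(Dt e_{y₀})(x)| ≤ C`.
* §5 toy (`d = 3`).

HONEST (what this is NOT).  By-name junctions only (the analysis is (152)–(154)); `d ≥ 3` only; constants existential (lit1's Green-function
constants behind `interior_estimate`) and far from sharp; cubic periods; scalar skeleton ((A3), NC-NE7b-α UNRULED); the covariance
OPERATOR of (100) (`A⁻¹∘inr` display) is not junctioned here (§3 is its written-out form); nothing of the covariant propagators of
[B4]–[B6]; nothing of Bałaban's.  BY-NAME EFFECT ON THE WALL: NONE.  NE7b NOT PRINTED ∕ NOT PROVED; spine PROVED 0∕9; rung (B)+1 on a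
FINITE torus — NOT infinite volume, NOT the mass gap, NOT Clay.  HONEST DEPENDENCY: continuum YM on T⁴ ⇐ BetaPertH ∧ nine spine estimates
(0∕9 proved); BetaPertH ⇐ (D1) ∧ (D4) ∧ CAP+tail; G-an2-4 gates asym, D1 and NE2∕3∕4.
-/

set_option autoImplicit false

noncomputable section

namespace Summit.QuantumFields.BalabanUV.T4Continuum.NE7b.SupTorusPointwiseRoadColumn

open Real
open scoped ENNReal
open Literature.MathematicalPhysics.QuantumFieldTheory.Balaban1983to89
open B6QGQLower276 (X e blk B side AX chart mem_B sum_B sum_B_const card_cube blk_chart)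
open B5Hk103ScalarZd (nbhd)
open Beta (Site siteOf windowMap siteOf_windowMap siteOf_add siteOf_sub)
open SupTorusDirichletForm (siteOf_chart_surjective blockOf_siteOf_of_mem)
open SupTorusHessianCombesThomas (exists_rate)
open SupTorusBlockDistance (isPseudoDist_torus)
open SupTorusActionForm (action_sub action_sum_smul)
open SupTorusCoarseFloor (nextScale_hessian_local)
open SupTorusResponseLocality (response_local)
open SupTorusCovarianceLocality (coeff_le)
open SupTorusMaximumPrinciple (blockRMS_le_of_block_source)
open SupTorusPointwiseDecayRoad (pointwise_decay_road)
open SupTorusResponseOperatorLocality (response_eq_superposition)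

variable {d : ℕ}

/-! ## §1. The propagator of a block source, pointwise, on the road's class -/

/-- **`e^{δρ_s(bt x, y₀)}·|H_V⁻¹f|(x) ≤ C·‖f‖_∞` ON THE ROAD'S CLASS `−λ ≤ V ≤ Λ`, `d ≥ 3`, every mesh, every volume**, for `f` supported in the
block `y₀` — (154) `pointwise_decay_road` at the profile rate `γ = 1` (a block source has every profile). [folklore] -/
theorem propagator_pointwise_decay_road (hd : 3 ≤ d) (a : ℝ) (ha : 0 < a) {lam Lam : ℝ} (hlam : lam < min 2 a) (hLam : 0 ≤ Lam) :
    ∃ C δ : ℝ, 0 < C ∧ 0 < δ ∧ ∀ (n s : ℕ) [NeZero s] (V : Site d ((n + 1) * s) → ℝ), (∀ x, -lam ≤ V x) → (∀ x, V x ≤ Lam) →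
      ∀ (y₀ : Site d s) (M : ℝ) (u f : Site d ((n + 1) * s) → ℝ), (∀ x, siteOf d s (blk n (windowMap d ((n + 1) * s) x)) ≠ y₀ → f x = 0) →
      (∀ x, |f x| ≤ M) →
      (∀ x, ((n : ℝ) + 1) ^ 2 * ∑ μ, (2 * u x - u (x + siteOf d ((n + 1) * s) (e μ)) - u (x - siteOf d ((n + 1) * s) (e μ)))
        + a / ((n : ℝ) + 1) ^ d * ∑ q ∈ B n (blk n (windowMap d ((n + 1) * s) x)), u (siteOf d ((n + 1) * s) q) + V x * u x = f x) →
      ∀ x : Site d ((n + 1) * s),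
        exp (δ * ∑ i, ((((siteOf d s (blk n (windowMap d ((n + 1) * s) x))) i - y₀ i).valMinAbs.natAbs : ℕ) : ℝ)) * |u x| ≤ C * M := by
  obtain ⟨C, δ, hC, hδ, H⟩ := pointwise_decay_road (d := d) hd a ha hlam hLam one_pos
  refine ⟨C, δ, hC, hδ, fun n s _ V hV hV' y₀ M u f hf hfM hu x => H n s V hV hV' y₀ M u f (fun x' => ?_) hu x⟩
  have hM : 0 ≤ M := (abs_nonneg _).trans (hfM x')
  by_cases hx : siteOf d s (blk n (windowMap d ((n + 1) * s) x')) = y₀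
  · rw [hx, (isPseudoDist_torus (d := d) s).zero y₀, mul_zero, neg_zero, exp_zero, mul_one]; exact hfM x'
  · rw [hf x' hx, abs_zero]; positivity

/-! ## §2. The response, pointwise, on the road's class -/

/-- **`e^{δρ_s(bt x, y₀)}·|h_{y₀}(x)| ≤ C` ON THE ROAD'S CLASS, `d ≥ 3`, every mesh, every volume**, for the response `h_{y₀} = Σ_{y′}T⁻¹(y′,y₀)ψ_{y′}`
(`= Dt e_{y₀}`, (100)∕(136)) of ANY block columns `ψ`: `Hh_{y₀} = T⁻¹(bt ·, y₀)` ((137) `response_local`), a source with the profile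
`c₁e^{−δ₁ρ_s(bt ·, y₀)}` ((135) `nextScale_hessian_local`), so (154) applies. [folklore] -/
theorem response_pointwise_decay_road (hd : 3 ≤ d) (a : ℝ) (ha : 0 < a) {lam Lam : ℝ} (hlam : lam < min 2 a) (hLam : 0 ≤ Lam) :
    ∃ C δ : ℝ, 0 < C ∧ 0 < δ ∧ ∀ (n s : ℕ) [NeZero s] (V : Site d ((n + 1) * s) → ℝ), (∀ x, -lam ≤ V x) → (∀ x, V x ≤ Lam) →
      ∀ ψ : Site d s → Site d ((n + 1) * s) → ℝ,
      (∀ y' x, ((n : ℝ) + 1) ^ 2 * ∑ μ, (2 * ψ y' x - ψ y' (x + siteOf d ((n + 1) * s) (e μ)) - ψ y' (x - siteOf d ((n + 1) * s) (e μ)))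
        + a / ((n : ℝ) + 1) ^ d * ∑ q ∈ B n (blk n (windowMap d ((n + 1) * s) x)), ψ y' (siteOf d ((n + 1) * s) q) + V x * ψ y' x
        = if siteOf d s (blk n (windowMap d ((n + 1) * s) x)) = y' then 1 else 0) →
      ∀ (y₀ : Site d s) (x : Site d ((n + 1) * s)),
        exp (δ * ∑ i, ((((siteOf d s (blk n (windowMap d ((n + 1) * s) x))) i - y₀ i).valMinAbs.natAbs : ℕ) : ℝ))
          * |∑ y', (Matrix.of fun yy y'' : Site d s =>
            (((n : ℝ) + 1) ^ d)⁻¹ * ∑ z : Fin d → Fin (n + 1), ψ y'' (siteOf d ((n + 1) * s) (chart n (windowMap d s yy) z)))⁻¹ y' y₀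
            * ψ y' x| ≤ C := by
  classical
  have hm0 : 0 < min 2 a - lam := by linarith
  obtain ⟨c₁, δ₁, hc₁, hδ₁, H135⟩ := nextScale_hessian_local (d := d) a ha hm0 hLam
  obtain ⟨C7, δ7, -, -, H137⟩ := response_local (d := d) a ha hm0 hLam
  obtain ⟨C, δ, hC, hδ, H⟩ := pointwise_decay_road (d := d) hd a ha hlam hLam hδ₁
  refine ⟨C * c₁, δ, by positivity, hδ, ?_⟩
  intro n s _ V hV hV' ψ hψ y₀ x
  set T : Matrix (Site d s) (Site d s) ℝ := Matrix.of fun yy y'' : Site d s =>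
    (((n : ℝ) + 1) ^ d)⁻¹ * ∑ z : Fin d → Fin (n + 1), ψ y'' (siteOf d ((n + 1) * s) (chart n (windowMap d s yy) z)) with hT_def
  obtain ⟨-, hH, -⟩ := H137 n s V hV hV' ψ hψ y₀
  have hsrc : ∀ x' : Site d ((n + 1) * s), |T⁻¹ (siteOf d s (blk n (windowMap d ((n + 1) * s) x'))) y₀|
      ≤ c₁ * exp (-(δ₁ * ∑ i, ((((siteOf d s (blk n (windowMap d ((n + 1) * s) x'))) i - y₀ i).valMinAbs.natAbs : ℕ) : ℝ))) :=
    fun x' => H135 n s V hV hV' ψ hψ _ y₀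
  have h := H n s V hV hV' y₀ c₁ (fun x' => ∑ y', T⁻¹ y' y₀ * ψ y' x')
    (fun x' => T⁻¹ (siteOf d s (blk n (windowMap d ((n + 1) * s) x'))) y₀) hsrc hH x
  linarith [h]

/-! ## §3. The fluctuation covariance, pointwise, on the road's class -/

/-- **`e^{δρ_s(bt x, y₀)}·|Cf|(x) ≤ C·‖f‖_∞` ON THE ROAD'S CLASS, `d ≥ 3`, every mesh, every volume**: for block columns `ψ`, `Hu = f` with `f`
supported in the block `y₀`, `|f| ≤ M`, the fluctuation part `u − h`, `h = Σ_{y′}c y′·ψ_{y′}`, `c = T⁻¹(Q′tu)`, has `H(u − h) = f − c∘bt` ((133)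
`action_sub` ∕ `action_sum_smul`) with `|c y′| ≤ c₁m_κ⁻¹e^{2dκ}K·M·e^{−δ′ρ_s(y′,y₀)}` ((139) `coeff_le`, (144) `blockRMS_le_of_block_source`), a
source with the profile `(1 + c₁m_κ⁻¹e^{2dκ}K)M·e^{−δ′ρ_s}`, so (154) applies. [folklore] -/
theorem covariance_pointwise_decay_road (hd : 3 ≤ d) (a : ℝ) (ha : 0 < a) {lam Lam : ℝ} (hlam : lam < min 2 a) (hLam : 0 ≤ Lam) :
    ∃ C δ : ℝ, 0 < C ∧ 0 < δ ∧ ∀ (n s : ℕ) [NeZero s] (V : Site d ((n + 1) * s) → ℝ), (∀ x, -lam ≤ V x) → (∀ x, V x ≤ Lam) →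
      ∀ ψ : Site d s → Site d ((n + 1) * s) → ℝ,
      (∀ y' x, ((n : ℝ) + 1) ^ 2 * ∑ μ, (2 * ψ y' x - ψ y' (x + siteOf d ((n + 1) * s) (e μ)) - ψ y' (x - siteOf d ((n + 1) * s) (e μ)))
        + a / ((n : ℝ) + 1) ^ d * ∑ q ∈ B n (blk n (windowMap d ((n + 1) * s) x)), ψ y' (siteOf d ((n + 1) * s) q) + V x * ψ y' x
        = if siteOf d s (blk n (windowMap d ((n + 1) * s) x)) = y' then 1 else 0) →
      ∀ (y₀ : Site d s) (M : ℝ) (u f : Site d ((n + 1) * s) → ℝ), (∀ x, siteOf d s (blk n (windowMap d ((n + 1) * s) x)) ≠ y₀ → f x = 0) →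
      (∀ x, |f x| ≤ M) →
      (∀ x, ((n : ℝ) + 1) ^ 2 * ∑ μ, (2 * u x - u (x + siteOf d ((n + 1) * s) (e μ)) - u (x - siteOf d ((n + 1) * s) (e μ)))
        + a / ((n : ℝ) + 1) ^ d * ∑ q ∈ B n (blk n (windowMap d ((n + 1) * s) x)), u (siteOf d ((n + 1) * s) q) + V x * u x = f x) →
      ∀ x : Site d ((n + 1) * s),
        exp (δ * ∑ i, ((((siteOf d s (blk n (windowMap d ((n + 1) * s) x))) i - y₀ i).valMinAbs.natAbs : ℕ) : ℝ))
          * |u x - ∑ y', (∑ y'', (Matrix.of fun yy y'' : Site d s =>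
              (((n : ℝ) + 1) ^ d)⁻¹ * ∑ z : Fin d → Fin (n + 1), ψ y'' (siteOf d ((n + 1) * s) (chart n (windowMap d s yy) z)))⁻¹ y' y''
            * ((((n : ℝ) + 1) ^ d)⁻¹ * ∑ z'' : Fin d → Fin (n + 1), u (siteOf d ((n + 1) * s) (chart n (windowMap d s y'') z''))))
            * ψ y' x| ≤ C * M := by
  classical
  have hdR : (0 : ℝ) ≤ d := Nat.cast_nonneg d
  have hm0 : 0 < min 2 a - lam := by linarith
  obtain ⟨κ, hκ0, hκ1, hκm⟩ := exists_rate (d := d) a ha.le hm0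
  have hm : 0 < min 2 a - lam - 2 * d * κ ^ 2 - a * (exp (2 * d * κ) - 1) := by linarith
  set m := min 2 a - lam - 2 * d * κ ^ 2 - a * (exp (2 * d * κ) - 1) with hm_def
  have hminv : 0 ≤ m⁻¹ := inv_nonneg.2 hm.le
  obtain ⟨c₁, δ₁, hc₁, hδ₁, H135⟩ := nextScale_hessian_local (d := d) a ha hm0 hLam
  set δ' : ℝ := min δ₁ (κ / 2) with hδ'_def
  have hδ'0 : 0 < δ' := lt_min hδ₁ (by linarith)
  have hδ'δ₁ : δ' ≤ δ₁ := min_le_left _ _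
  have h2δ' : 2 * δ' ≤ κ := by have := min_le_right δ₁ (κ / 2); rw [← hδ'_def] at this; linarith
  set K : ℝ := (2 * (1 - exp (-δ'))⁻¹) ^ d with hK
  have hK0 : 0 ≤ K := pow_nonneg (mul_nonneg zero_le_two (inv_nonneg.2 (sub_nonneg.2 (exp_le_one_iff.2 (by linarith))))) d
  obtain ⟨C, δ, hC, hδ, H⟩ := pointwise_decay_road (d := d) hd a ha hlam hLam hδ'0
  refine ⟨C * (1 + c₁ * (m⁻¹ * exp (2 * d * κ)) * K), δ, by positivity, hδ, ?_⟩
  intro n s _ V hV hV' ψ hψ y₀ M u f hf hfM hu x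
  set T : Matrix (Site d s) (Site d s) ℝ := Matrix.of fun yy y'' : Site d s =>
    (((n : ℝ) + 1) ^ d)⁻¹ * ∑ z : Fin d → Fin (n + 1), ψ y'' (siteOf d ((n + 1) * s) (chart n (windowMap d s yy) z)) with hT_def
  have hM : 0 ≤ M := (abs_nonneg _).trans (hfM x)
  have hTinv : ∀ y y' : Site d s, |T⁻¹ y y'| ≤ c₁ * exp (-(δ₁ * ∑ i, (((y i - y' i).valMinAbs.natAbs : ℕ) : ℝ))) :=
    fun y y' => H135 n s V hV hV' ψ hψ y y'
  set cc : Site d s → ℝ := fun y' => ∑ y'', T⁻¹ y' y''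
    * ((((n : ℝ) + 1) ^ d)⁻¹ * ∑ z'' : Fin d → Fin (n + 1), u (siteOf d ((n + 1) * s) (chart n (windowMap d s y'') z''))) with hcc
  set hfl : Site d ((n + 1) * s) → ℝ := fun x => ∑ y', cc y' * ψ y' x with hhfl
  have hR := blockRMS_le_of_block_source n s y₀ f hf hfM
  -- the coefficients decay like the source block's distance
  have hcoef : ∀ y', |cc y'| ≤ c₁ * (m⁻¹ * exp (2 * d * κ)) * K * M * exp (-(δ' * ∑ i, (((y' i - y₀ i).valMinAbs.natAbs : ℕ) : ℝ))) := by
    intro y'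
    refine (coeff_le n a s V (fun y' y'' => T⁻¹ y' y'') u ha.le hκ0.le hκ1 hm hδ'0 hδ'δ₁ h2δ' hc₁.le hV hTinv y₀ f hf hu y').trans ?_
    have hE := exp_pos (-(δ' * ∑ i, (((y' i - y₀ i).valMinAbs.natAbs : ℕ) : ℝ)))
    have : c₁ * (m⁻¹ * exp (2 * d * κ) * √((((n : ℝ) + 1) ^ d)⁻¹ * ∑ x, f x ^ 2)) * K ≤ c₁ * (m⁻¹ * exp (2 * d * κ) * M) * K :=
      mul_le_mul_of_nonneg_right (mul_le_mul_of_nonneg_left (mul_le_mul_of_nonneg_left hR (by positivity)) hc₁.le) hK0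
    calc c₁ * (m⁻¹ * exp (2 * d * κ) * √((((n : ℝ) + 1) ^ d)⁻¹ * ∑ x, f x ^ 2)) * K
          * exp (-(δ' * ∑ i, (((y' i - y₀ i).valMinAbs.natAbs : ℕ) : ℝ)))
        ≤ c₁ * (m⁻¹ * exp (2 * d * κ) * M) * K * exp (-(δ' * ∑ i, (((y' i - y₀ i).valMinAbs.natAbs : ℕ) : ℝ))) :=
          mul_le_mul_of_nonneg_right this hE.le
      _ = _ := by ring
  -- the displays of `u − hfl`: `H(u − hfl) = f − cc∘bt`
  have hHfl : ∀ x', ((n : ℝ) + 1) ^ 2 * ∑ μ, (2 * hfl x' - hfl (x' + siteOf d ((n + 1) * s) (e μ)) - hfl (x' - siteOf d ((n + 1) * s) (e μ)))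
      + a / ((n : ℝ) + 1) ^ d * ∑ q ∈ B n (blk n (windowMap d ((n + 1) * s) x')), hfl (siteOf d ((n + 1) * s) q) + V x' * hfl x'
      = cc (siteOf d s (blk n (windowMap d ((n + 1) * s) x'))) := by
    intro x'
    simp only [hhfl]
    rw [action_sum_smul n a s Finset.univ cc ψ V x']
    simp only [hψ, mul_ite, mul_one, mul_zero, Finset.sum_ite_eq, Finset.mem_univ, if_true]
  have hdiff : ∀ x', ((n : ℝ) + 1) ^ 2 * ∑ μ, (2 * (u x' - hfl x') - (u (x' + siteOf d ((n + 1) * s) (e μ)) - hfl (x' + siteOf d ((n + 1) * s) (e μ)))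
        - (u (x' - siteOf d ((n + 1) * s) (e μ)) - hfl (x' - siteOf d ((n + 1) * s) (e μ))))
      + a / ((n : ℝ) + 1) ^ d * ∑ q ∈ B n (blk n (windowMap d ((n + 1) * s) x')), (u (siteOf d ((n + 1) * s) q) - hfl (siteOf d ((n + 1) * s) q))
      + V x' * (u x' - hfl x') = f x' - cc (siteOf d s (blk n (windowMap d ((n + 1) * s) x'))) := by
    intro x'; rw [action_sub n a s V u hfl x', hu x', hHfl x']
  -- the source `f − cc∘bt` has the profile `(1 + c₁m⁻¹e^{2dκ}K)M·e^{−δ′ρ_s(bt ·, y₀)}`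
  have hsrc : ∀ x', |f x' - cc (siteOf d s (blk n (windowMap d ((n + 1) * s) x')))|
      ≤ (1 + c₁ * (m⁻¹ * exp (2 * d * κ)) * K) * M
        * exp (-(δ' * ∑ i, ((((siteOf d s (blk n (windowMap d ((n + 1) * s) x'))) i - y₀ i).valMinAbs.natAbs : ℕ) : ℝ))) := by
    intro x'
    have hc := hcoef (siteOf d s (blk n (windowMap d ((n + 1) * s) x')))
    have hE := exp_pos (-(δ' * ∑ i, ((((siteOf d s (blk n (windowMap d ((n + 1) * s) x'))) i - y₀ i).valMinAbs.natAbs : ℕ) : ℝ)))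
    have hfx : |f x'| ≤ M * exp (-(δ' * ∑ i, ((((siteOf d s (blk n (windowMap d ((n + 1) * s) x'))) i - y₀ i).valMinAbs.natAbs : ℕ) : ℝ))) := by
      by_cases hx : siteOf d s (blk n (windowMap d ((n + 1) * s) x')) = y₀
      · rw [hx, (isPseudoDist_torus (d := d) s).zero y₀, mul_zero, neg_zero, exp_zero, mul_one]; exact hfM x'
      · rw [hf x' hx, abs_zero]; positivity
    calc |f x' - cc (siteOf d s (blk n (windowMap d ((n + 1) * s) x')))|
        ≤ |f x'| + |cc (siteOf d s (blk n (windowMap d ((n + 1) * s) x')))| := abs_sub _ _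
      _ ≤ M * exp (-(δ' * ∑ i, ((((siteOf d s (blk n (windowMap d ((n + 1) * s) x'))) i - y₀ i).valMinAbs.natAbs : ℕ) : ℝ)))
          + c₁ * (m⁻¹ * exp (2 * d * κ)) * K * M
          * exp (-(δ' * ∑ i, ((((siteOf d s (blk n (windowMap d ((n + 1) * s) x'))) i - y₀ i).valMinAbs.natAbs : ℕ) : ℝ))) := add_le_add hfx hc
      _ = _ := by ring
  have h := H n s V hV hV' y₀ ((1 + c₁ * (m⁻¹ * exp (2 * d * κ)) * K) * M) (fun x' => u x' - hfl x')
    (fun x' => f x' - cc (siteOf d s (blk n (windowMap d ((n + 1) * s) x')))) hsrc hdiff x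
  simp only [hhfl, hcc] at h
  linarith [h]

/-! ## §4. The road's own response operator `Dt`, pointwise, on the road's class — by name -/

/-- **`e^{δρ_s(bt x, y₀)}·|(Dt e_{y₀})(x)| ≤ C` ON THE ROAD'S CLASS `u′(φ ·) ∈ [−λ, Λ]`, `d ≥ 3`, every mesh, every volume**, for the road's
response OPERATOR `Dt` of (100) (operators `Dop, Aop, Ef, Rf, Rc` with the road's displays, `Q′t(Dt k) = k`, the fibre-killing display, `Mt`
with (102)'s display — (150)'s quantifier prefix verbatim with the floor `v₀` replaced by `−λ`): `Dt k = Σ(Mt k)ψ` with `Mt = T⁻¹` ((150)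
`response_eq_superposition`), and §2. [folklore] -/
theorem response_operator_pointwise_road (hd : 3 ≤ d) (a : ℝ) (ha : 0 < a) {lam Lam : ℝ} (hlam : lam < min 2 a) (hLam : 0 ≤ Lam) :
    ∃ C δ : ℝ, 0 < C ∧ 0 < δ ∧ ∀ (n s : ℕ) [NeZero s]
      (Dop Aop : lp (fun _ : X d => ℝ) ∞ →L[ℝ] lp (fun _ : X d => ℝ) ∞),
      (∀ (f : lp (fun _ : X d => ℝ) ∞) (y : X d), Dop f y = (((n : ℝ) + 1) ^ d)⁻¹ * ∑ p ∈ B n y, f p) →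
      (∀ (f : lp (fun _ : X d => ℝ) ∞) (p : X d), Aop f p = ∑ r ∈ nbhd n p, AX n a p r * f r) →
      ∀ (Ef : (Site d ((n + 1) * s) → ℝ) →L[ℝ] lp (fun _ : X d => ℝ) ∞),
      (∀ (g : Site d ((n + 1) * s) → ℝ) (q : X d), Ef g q = g (siteOf d ((n + 1) * s) q)) →
      ∀ (Rf : lp (fun _ : X d => ℝ) ∞ →L[ℝ] (Site d ((n + 1) * s) → ℝ)),
      (∀ (h : lp (fun _ : X d => ℝ) ∞) (x : Site d ((n + 1) * s)), Rf h x = h (windowMap d ((n + 1) * s) x)) →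
      ∀ (Rc : lp (fun _ : X d => ℝ) ∞ →L[ℝ] (Site d s → ℝ)),
      (∀ (h : lp (fun _ : X d => ℝ) ∞) (x : Site d s), Rc h x = h (windowMap d s x)) →
      ∀ (u' : ℝ → ℝ) (φ : Site d ((n + 1) * s) → ℝ), (∀ x, -lam ≤ u' (φ x)) → (∀ x, u' (φ x) ≤ Lam) →
      ∀ (Dt : (Site d s → ℝ) →L[ℝ] (Site d ((n + 1) * s) → ℝ)),
      (∀ k : Site d s → ℝ, ((Rc.comp Dop).comp Ef) (Dt k) = k) →
      (∀ (k : Site d s → ℝ) (κ' : Site d ((n + 1) * s) → ℝ), ((Rc.comp Dop).comp Ef) κ' = 0 →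
        ∑ x, (((Rf.comp Aop).comp Ef) (Dt k) x + u' (φ x) * Dt k x) * κ' x = 0) →
      ∀ (Mt : (Site d s → ℝ) →L[ℝ] (Site d s → ℝ)),
      (∀ (k : Site d s → ℝ) (y : Site d s),
        Mt k y = ((Rc.comp Dop).comp Ef) (fun x => ((Rf.comp Aop).comp Ef) (Dt k) x + u' (φ x) * Dt k x) y) →
      ∀ (y₀ : Site d s) (x : Site d ((n + 1) * s)),
        exp (δ * ∑ i, ((((siteOf d s (blk n (windowMap d ((n + 1) * s) x))) i - y₀ i).valMinAbs.natAbs : ℕ) : ℝ))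
          * |Dt (fun y'' => if y'' = y₀ then 1 else 0) x| ≤ C := by
  classical
  have hm0 : 0 < min 2 a - lam := by linarith
  obtain ⟨C, δ, hC, hδ, H2⟩ := response_pointwise_decay_road (d := d) hd a ha hlam hLam
  refine ⟨C, δ, hC, hδ, ?_⟩
  intro n s _ Dop Aop hD hA Ef hEf Rf hRf Rc hRc u' φ hu hu' Dt hDQ hDlin Mt hMt y₀ x
  obtain ⟨ψ, hψ, hsuper, hent⟩ := response_eq_superposition (d := d) a ha hm0 n s Dop Aop hD hA Ef hEf Rf hRf Rc hRc u' φ hu Dt hDQ hDlin Mt hMt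
  have hDt : Dt (fun y'' => if y'' = y₀ then 1 else 0) x = ∑ y', (Matrix.of fun yy y'' : Site d s =>
      (((n : ℝ) + 1) ^ d)⁻¹ * ∑ z : Fin d → Fin (n + 1), ψ y'' (siteOf d ((n + 1) * s) (chart n (windowMap d s yy) z)))⁻¹ y' y₀ * ψ y' x := by
    rw [← hsuper (fun y'' => if y'' = y₀ then 1 else 0)]
    exact Finset.sum_congr rfl fun y' _ => by rw [hent y' y₀]
  rw [hDt]
  exact H2 n s (fun x => u' (φ x)) hu hu' ψ hψ y₀ x

/-! ## §5. Toy -/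

/-- Toy (`d = 3`, `a = 1`, `λ = 0`, `Λ = 1`): the constants of §3 exist. -/
example : ∃ C δ : ℝ, 0 < C ∧ 0 < δ :=
  let ⟨C, δ, hC, hδ, _⟩ := covariance_pointwise_decay_road (d := 3) le_rfl 1 one_pos (lam := 0) (Lam := 1)
    (by rw [min_eq_right (by norm_num : (1 : ℝ) ≤ 2)]; norm_num) zero_le_one
  ⟨C, δ, hC, hδ⟩

end Summit.QuantumFields.BalabanUV.T4Continuum.NE7b.SupTorusPointwiseRoadColumn
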